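import Mathlib.MeasureTheory.PiSystem
import Mathlib.Topology.Algebra.OpenSubgroup
import Mathlib.Topology.Algebra.ContinuousMonoidHom
import Mathlib.Topology.Bases
import HarnessLib

/-!
# F0 · P3c · line LH6 «StCharTS» — WIF antecedent, ELLIPTIC half via the ★ Cayley window: brick (C1a) «FILTERED NEWTON SANDWICH — COSETS» —
# a map that is «the identity up to one level» on a filtered abelian group is injective on the base box and permutes the cosets of every deeper level

Cell `pub/hodgecm-mathlib`, crux H413 = `stmt-HodgeConjecture-24833` (lane `--supports … --as helper`), route HCCMUnconditional; seat LH5-p02 (g6)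
(free LH5 hand under LEAD T13-42 priority (2); offer «JAC-ELL via the ★ CAYLEY WINDOW» to the JAC-LOC ∕ (TOR)-road holder LH6-p03 (g5), the ELL-TOR★
holder F0P3a-p05 (g22) and the datum-road map owner LH6-p01, bus F0∕P3b 2026-09-02T14:29Z).  THEOREMS ONLY (no definition ∕ instance ∕ notation ∕ named
fact ∕ `sorry`); Mathlib only.  File 1∕2 (cosets); file 2∕2 `F0P3cStCharTSFilteredNewtonHaar` (Haar measure).  This is the abelian ∕ Lie-algebra twin of
★ (J4a) `F0P3cStCharTSAbelianSandwich` + the (J5) Newton step of the JAC-LOC road: in a Cayley chart (★ `Literature/NumberTheory/Weil1982/UnitaryFinCayleyWindow*`,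
coset for coset, Ad-equivariant, for `G = Z(1)` and for a compact Cartan `T = Z(γ₀)` alike) the tube map at a regular `t₀ ∈ T` is `L + (one level deeper)`
with `L = (Ad t₀⁻¹ − 1) ⊕ id`, and the transport of Haar measure under the Cayley map itself is the case `L = id`.

SETTING.  `V` an additive group with a decreasing sequence of subgroups `Λ 0 ≥ Λ 1 ≥ …`; topologically: `V` Hausdorff, the `Λ j` OPEN and a basis of
neighbourhoods of `0`, the base box `Λ k` COMPACT (the model: a finite free module over a non-archimedean local ring, `Λ j = ϖʲ Λ₀`).  A map `ψ : V → V`,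
continuous on `Λ k`, satisfies the **filtered Newton hypothesis at depth `k`**

  `(N)  ∀ j ≥ k, ∀ x ∈ Λ k, ∀ y ∈ Λ j,  ψ (x + y) − ψ x − y ∈ Λ (j + 1)`

(«`ψ` is the identity up to one level, uniformly on the base box»; the shape of `X ↦ cay⁻¹(cay(W)·cay(X))`, of twisted conjugation in a Cayley ∕ exponential
chart after dividing by its linear part, of any `LX + (quadratic)` with `L⁻¹` applied, once `k` is deep enough).  With a LINEAR PART `L : V ≃ₜ+ W` the hypothesis
reads `(N_L) φ (x + y) − φ x − L y ∈ L '' Λ (j+1)` and reduces to `(N)` for `ψ := L⁻¹ ∘ φ` (§3).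

THE RESULTS (all PROVED).
* §1 coset calculus (`vadd_coe_eq_vadd_coe_of_mem`, nested-or-disjoint `vadd_coe_subset_vadd_coe_of_mem`, `isPiSystem_cosets`, `vadd_coe_subset_or_disjoint`)
  and the two ALGEBRAIC Newton steps: `sub_mem_of_newton` (equal images ⇒ difference in every `Λ j`, induction on the level), `mapsTo_vadd_of_newton`
  (`ψ (x + Λ j) ⊆ ψ x + Λ j`), `exists_approx_of_newton` (for every `n` an approximate solution `y ∈ Λ j` of `ψ (x + y) = ψ x + z` with error in `Λ (j+1+n)`).
* §2 `eq_zero_of_forall_mem` (`⋂ Λ j = 0`), `injOn_of_newton` — **`ψ` is injective on `Λ k`**; `exists_eq_add_of_newton`, `image_vadd_eq_of_newton` —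
  **`ψ '' (x + Λ j) = ψ x + Λ j`** for `j ≥ k`, `x ∈ Λ k` (Cantor's intersection theorem in the compact `Λ j` upgrades the approximate solutions to an exact one
  — no completeness API, no series); `image_coe_eq_of_newton` (`ψ '' Λ k = Λ k` when `ψ 0 ∈ Λ k`); `inter_preimage_vadd_eq_of_newton`
  (`Λ k ∩ ψ⁻¹(ψ x + Λ j) = x + Λ j`); `isTopologicalBasis_cosets` (the cosets `v + Λ j`, `j ≥ k`, are a topological basis).
* §3 linear part: `newton_symm_comp_of_linearNewton`, `injOn_of_linearNewton`, `image_vadd_eq_of_linearNewton` (`φ '' (x + Λ j) = φ x + L '' Λ j`).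

HONEST LABEL: HC_CM is proved only modulo the 7 printed citations (2 remaining named inputs: hLiu418 = `stmt-HodgeConjecture-24832`, h413 =
`stmt-HodgeConjecture-24833`) until rung 0 closes; this file closes no organ (count-neutral bank for the elliptic half of the WIF antecedent of RUNG0).

## References
* [Serre1992LALG] J.-P. Serre, *Lie Algebras and Lie Groups*, LNM 1500 (1992), Part II Ch. IV §8–§9 (standard groups and their filtrations). Context locator.
* [HarishChandra1970] Harish-Chandra (notes by G. van Dijk), *Harmonic Analysis on Reductive p-adic Groups*, LNM 162 (1970), Lemma 22 (the consumer).
-/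


set_option autoImplicit false
set_option linter.dupNamespace false

open Set Filter TopologicalSpace
open scoped Pointwise Topology

namespace Summit.HodgeConjecture.HodgeConjecture.Cruxes.H413.F0P3cStCharTSFilteredNewton

/-! ## §1 Coset calculus of the filtration and the purely algebraic Newton steps -/

section Algebra

variable {V : Type*} [AddCommGroup V] (Λ : ℕ → AddSubgroup V) {k : ℕ} (ψ : V → V)

/-- A coset of `Λ j` through a point of a coset is that coset. [cite: Serre1992LALG, Part II Ch. IV §9] -/
theorem vadd_coe_eq_vadd_coe_of_mem {j : ℕ} {u v : V} (hu : u ∈ v +ᵥ (Λ j : Set V)) :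
    u +ᵥ (Λ j : Set V) = v +ᵥ (Λ j : Set V) := by
  rw [leftAddCoset_eq_iff]
  obtain ⟨l, hl, rfl⟩ := hu
  simpa using neg_mem hl

/-- Two cosets of the filtration that meet are nested: the deeper one is contained in the other. [cite: Serre1992LALG, Part II Ch. IV §9] -/
theorem vadd_coe_subset_vadd_coe_of_mem (hanti : Antitone Λ) {i j : ℕ} (hij : i ≤ j) {u v₁ v₂ : V}
    (h₁ : u ∈ v₁ +ᵥ (Λ i : Set V)) (h₂ : u ∈ v₂ +ᵥ (Λ j : Set V)) :
    v₂ +ᵥ (Λ j : Set V) ⊆ v₁ +ᵥ (Λ i : Set V) := by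
  rw [← vadd_coe_eq_vadd_coe_of_mem Λ h₁, ← vadd_coe_eq_vadd_coe_of_mem Λ h₂]
  exact Set.vadd_set_mono (hanti hij)

/-- The cosets `v + Λ j`, `j ≥ k`, form a π-system (two cosets that meet are nested). [cite: Serre1992LALG, Part II Ch. IV §9] -/
theorem isPiSystem_cosets (hanti : Antitone Λ) :
    IsPiSystem {S : Set V | ∃ j, k ≤ j ∧ ∃ v : V, S = v +ᵥ (Λ j : Set V)} := by
  rintro _ ⟨i, hi, v₁, rfl⟩ _ ⟨j, hj, v₂, rfl⟩ ⟨u, hu₁, hu₂⟩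
  rcases le_total i j with hij | hji
  · exact ⟨j, hj, v₂, inter_eq_right.2 (vadd_coe_subset_vadd_coe_of_mem Λ hanti hij hu₁ hu₂)⟩
  · exact ⟨i, hi, v₁, inter_eq_left.2 (vadd_coe_subset_vadd_coe_of_mem Λ hanti hji hu₂ hu₁)⟩

/-- A coset of `Λ j` (`j ≥ k`) either lies in the base box `Λ k` or misses it. [cite: Serre1992LALG, Part II Ch. IV §9] -/
theorem vadd_coe_subset_or_disjoint (hanti : Antitone Λ) {j : ℕ} (hj : k ≤ j) (v : V) :
    v +ᵥ (Λ j : Set V) ⊆ (Λ k : Set V) ∨ Disjoint (v +ᵥ (Λ j : Set V)) (Λ k : Set V) := by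
  by_cases h : ((v +ᵥ (Λ j : Set V)) ∩ (Λ k : Set V)).Nonempty
  · obtain ⟨u, hu, huk⟩ := h
    have h0 : u ∈ (0 : V) +ᵥ (Λ k : Set V) := by simpa using huk
    exact Or.inl (by simpa using vadd_coe_subset_vadd_coe_of_mem Λ hanti hj h0 hu)
  · exact Or.inr (Set.disjoint_iff_inter_eq_empty.2 (Set.not_nonempty_iff_eq_empty.1 h))

/-- Under the filtered Newton hypothesis, two points of the base box with the same image differ by an
element of every `Λ j`, `j ≥ k` (induction on the level). [cite: Serre1992LALG, Part II Ch. IV §9] -/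
theorem sub_mem_of_newton
    (hN : ∀ j, k ≤ j → ∀ x ∈ Λ k, ∀ y ∈ Λ j, ψ (x + y) - ψ x - y ∈ Λ (j + 1))
    {x x' : V} (hx : x ∈ Λ k) (hx' : x' ∈ Λ k) (h : ψ x = ψ x') {j : ℕ} (hj : k ≤ j) : x' - x ∈ Λ j := by
  induction j, hj using Nat.le_induction with
  | base => exact sub_mem hx' hx
  | succ j hj ih =>
    have key := hN j hj x hx (x' - x) ih
    rw [add_sub_cancel, ← h, sub_self, zero_sub] at key
    simpa using neg_mem key

/-- The easy inclusion: `ψ (x + Λ j) ⊆ ψ x + Λ j`. [cite: Serre1992LALG, Part II Ch. IV §9] -/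
theorem mapsTo_vadd_of_newton (hanti : Antitone Λ)
    (hN : ∀ j, k ≤ j → ∀ x ∈ Λ k, ∀ y ∈ Λ j, ψ (x + y) - ψ x - y ∈ Λ (j + 1))
    {j : ℕ} (hj : k ≤ j) {x : V} (hx : x ∈ Λ k) :
    MapsTo ψ (x +ᵥ (Λ j : Set V)) (ψ x +ᵥ (Λ j : Set V)) := by
  rintro _ ⟨y, hy, rfl⟩
  refine ⟨ψ (x + y) - ψ x, ?_, by simp [vadd_eq_add]⟩
  have h := hN j hj x hx y hy
  have : ψ (x + y) - ψ x = (ψ (x + y) - ψ x - y) + y := by abel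
  rw [this]
  exact add_mem (hanti (Nat.le_succ j) h) hy

/-- **Finite Newton iteration**: for every `n` there is an approximate solution `y ∈ Λ j` of
`ψ (x + y) = ψ x + z` with error in `Λ (j + 1 + n)`. [cite: Serre1992LALG, Part II Ch. IV §9] -/
theorem exists_approx_of_newton (hanti : Antitone Λ)
    (hN : ∀ j, k ≤ j → ∀ x ∈ Λ k, ∀ y ∈ Λ j, ψ (x + y) - ψ x - y ∈ Λ (j + 1))
    {j : ℕ} (hj : k ≤ j) {x : V} (hx : x ∈ Λ k) {z : V} (hz : z ∈ Λ j) (n : ℕ) :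
    ∃ y ∈ Λ j, ψ x + z - ψ (x + y) ∈ Λ (j + 1 + n) := by
  induction n with
  | zero =>
    refine ⟨z, hz, ?_⟩
    have h := hN j hj x hx z hz
    have : ψ x + z - ψ (x + z) = -(ψ (x + z) - ψ x - z) := by abel
    rw [this, add_zero]
    exact neg_mem h
  | succ n ih =>
    obtain ⟨y, hy, hd⟩ := ih
    set d := ψ x + z - ψ (x + y) with hd_def
    have hdj : d ∈ Λ j := hanti (by omega) hd
    have hxy : x + y ∈ Λ k := add_mem hx (hanti hj hy)
    refine ⟨y + d, add_mem hy hdj, ?_⟩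
    have key := hN (j + 1 + n) (by omega) (x + y) hxy d hd
    have : ψ x + z - ψ (x + (y + d)) = -(ψ (x + y + d) - ψ (x + y) - d) := by
      rw [← add_assoc]; simp only [hd_def]; abel
    rw [this, show j + 1 + (n + 1) = j + 1 + n + 1 by omega]
    exact neg_mem key

end Algebra

/-! ## §2 Topology: the intersection of the filtration, injectivity, exact Newton solutions -/

section Topology

variable {V : Type*} [AddCommGroup V] [TopologicalSpace V] (Λ : ℕ → AddSubgroup V) {k : ℕ} (ψ : V → V)

/-- In a Hausdorff group, a decreasing sequence of subgroups that is a neighbourhood basis of `0` has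
intersection `0` above any level. [cite: Serre1992LALG, Part II Ch. IV §9] -/
theorem eq_zero_of_forall_mem [T2Space V] (hanti : Antitone Λ)
    (hbasis : ∀ U ∈ 𝓝 (0 : V), ∃ j, (Λ j : Set V) ⊆ U) {y : V} (hy : ∀ j, k ≤ j → y ∈ Λ j) : y = 0 := by
  by_contra hne
  obtain ⟨j, hj⟩ := hbasis {y}ᶜ (isOpen_compl_singleton.mem_nhds (by simpa using fun h => hne h.symm))
  have hmem : y ∈ (Λ (max j k) : Set V) := hy _ (le_max_right _ _)
  exact hj (hanti (le_max_left j k) hmem) rfl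

/-- The subgroups above the compact base level are compact. [cite: Serre1992LALG, Part II Ch. IV §9] -/
theorem isCompact_of_le [IsTopologicalAddGroup V] (hanti : Antitone Λ) (hopen : ∀ j, IsOpen (Λ j : Set V))
    (hcomp : IsCompact (Λ k : Set V)) {j : ℕ} (hj : k ≤ j) : IsCompact (Λ j : Set V) :=
  hcomp.of_isClosed_subset ((Λ j).isClosed_of_isOpen (hopen j)) (hanti hj)

/-- **Injectivity on the base box.** [cite: Serre1992LALG, Part II Ch. IV §9] -/
theorem injOn_of_newton [T2Space V] (hanti : Antitone Λ)
    (hbasis : ∀ U ∈ 𝓝 (0 : V), ∃ j, (Λ j : Set V) ⊆ U)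
    (hN : ∀ j, k ≤ j → ∀ x ∈ Λ k, ∀ y ∈ Λ j, ψ (x + y) - ψ x - y ∈ Λ (j + 1)) :
    InjOn ψ (Λ k : Set V) := by
  intro x hx x' hx' h
  have h0 : x' - x = 0 :=
    eq_zero_of_forall_mem Λ hanti hbasis fun j hj => sub_mem_of_newton Λ ψ hN hx hx' h hj
  exact (sub_eq_zero.1 h0).symm

/-- **Exact solution by Cantor's intersection theorem**: for `j ≥ k`, `x ∈ Λ k`, `z ∈ Λ j` there is `y ∈ Λ j` with
`ψ (x + y) = ψ x + z`. [cite: Serre1992LALG, Part II Ch. IV §9] -/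
theorem exists_eq_add_of_newton [IsTopologicalAddGroup V] [T2Space V] (hanti : Antitone Λ)
    (hopen : ∀ j, IsOpen (Λ j : Set V))
    (hcomp : IsCompact (Λ k : Set V)) (hbasis : ∀ U ∈ 𝓝 (0 : V), ∃ j, (Λ j : Set V) ⊆ U)
    (hψ : ContinuousOn ψ (Λ k : Set V))
    (hN : ∀ j, k ≤ j → ∀ x ∈ Λ k, ∀ y ∈ Λ j, ψ (x + y) - ψ x - y ∈ Λ (j + 1))
    {j : ℕ} (hj : k ≤ j) {x : V} (hx : x ∈ Λ k) {z : V} (hz : z ∈ Λ j) :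
    ∃ y ∈ Λ j, ψ (x + y) = ψ x + z := by
  -- the nested closed sets of approximate solutions
  set S : ℕ → Set V := fun n =>
    {y | y ∈ (Λ j : Set V) ∧ ψ x + z - ψ (x + y) ∈ (Λ (j + 1 + n) : Set V)} with hS
  have hcont : ContinuousOn (fun y => ψ x + z - ψ (x + y)) (Λ j : Set V) := by
    refine continuousOn_const.sub (hψ.comp (continuousOn_const.add continuousOn_id) ?_)
    intro y hy
    exact add_mem hx (hanti hj hy)
  have hScl : ∀ n, IsClosed (S n) := fun n =>
    hcont.preimage_isClosed_of_isClosed ((Λ j).isClosed_of_isOpen (hopen j))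
      ((Λ _).isClosed_of_isOpen (hopen _))
  have hSd : ∀ n, S (n + 1) ⊆ S n := fun n y hy => ⟨hy.1, hanti (by omega) hy.2⟩
  have hSn : ∀ n, (S n).Nonempty := fun n => by
    obtain ⟨y, hy, h⟩ := exists_approx_of_newton Λ ψ hanti hN hj hx hz n
    exact ⟨y, hy, h⟩
  have hS0 : IsCompact (S 0) :=
    (isCompact_of_le Λ hanti hopen hcomp hj).of_isClosed_subset (hScl 0) fun y hy => hy.1
  obtain ⟨y, hy⟩ := IsCompact.nonempty_iInter_of_sequence_nonempty_isCompact_isClosed S hSd hSn hS0 hScl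
  rw [Set.mem_iInter] at hy
  refine ⟨y, (hy 0).1, ?_⟩
  have h0 : ψ x + z - ψ (x + y) = 0 := by
    refine eq_zero_of_forall_mem Λ (k := k) hanti hbasis fun i hi => ?_
    by_cases hij : i ≤ j + 1
    · exact hanti hij (by simpa using (hy 0).2)
    · have := (hy (i - (j + 1))).2
      rwa [show j + 1 + (i - (j + 1)) = i by omega] at this
  exact (sub_eq_zero.1 h0).symm

/-- **`ψ` maps the coset `x + Λ j` ONTO the coset `ψ x + Λ j`** (`j ≥ k`, `x ∈ Λ k`). [cite: Serre1992LALG, Part II Ch. IV §9] -/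
theorem image_vadd_eq_of_newton [IsTopologicalAddGroup V] [T2Space V] (hanti : Antitone Λ)
    (hopen : ∀ j, IsOpen (Λ j : Set V))
    (hcomp : IsCompact (Λ k : Set V)) (hbasis : ∀ U ∈ 𝓝 (0 : V), ∃ j, (Λ j : Set V) ⊆ U)
    (hψ : ContinuousOn ψ (Λ k : Set V))
    (hN : ∀ j, k ≤ j → ∀ x ∈ Λ k, ∀ y ∈ Λ j, ψ (x + y) - ψ x - y ∈ Λ (j + 1))
    {j : ℕ} (hj : k ≤ j) {x : V} (hx : x ∈ Λ k) :
    ψ '' (x +ᵥ (Λ j : Set V)) = ψ x +ᵥ (Λ j : Set V) := by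
  refine (mapsTo_vadd_of_newton Λ ψ hanti hN hj hx).image_subset.antisymm ?_
  rintro _ ⟨z, hz, rfl⟩
  obtain ⟨y, hy, h⟩ := exists_eq_add_of_newton Λ ψ hanti hopen hcomp hbasis hψ hN hj hx hz
  exact ⟨x + y, ⟨y, hy, rfl⟩, by simpa [vadd_eq_add] using h⟩

/-- The base box is mapped onto itself when `ψ 0 ∈ Λ k`. [cite: Serre1992LALG, Part II Ch. IV §9] -/
theorem image_coe_eq_of_newton [IsTopologicalAddGroup V] [T2Space V] (hanti : Antitone Λ)
    (hopen : ∀ j, IsOpen (Λ j : Set V))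
    (hcomp : IsCompact (Λ k : Set V)) (hbasis : ∀ U ∈ 𝓝 (0 : V), ∃ j, (Λ j : Set V) ⊆ U)
    (hψ : ContinuousOn ψ (Λ k : Set V))
    (hN : ∀ j, k ≤ j → ∀ x ∈ Λ k, ∀ y ∈ Λ j, ψ (x + y) - ψ x - y ∈ Λ (j + 1))
    (h0 : ψ 0 ∈ Λ k) : ψ '' (Λ k : Set V) = (Λ k : Set V) := by
  have h := image_vadd_eq_of_newton Λ ψ hanti hopen hcomp hbasis hψ hN le_rfl (zero_mem (Λ k))
  have hψ0 : ψ 0 ∈ (0 : V) +ᵥ (Λ k : Set V) := by simpa using h0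
  rw [zero_vadd] at h
  rw [h, vadd_coe_eq_vadd_coe_of_mem Λ hψ0, zero_vadd]

/-- The trace of a coset-preimage on the base box: for `x ∈ Λ k`, `j ≥ k`,
`Λ k ∩ ψ ⁻¹' (ψ x + Λ j) = x + Λ j`. [cite: Serre1992LALG, Part II Ch. IV §9] -/
theorem inter_preimage_vadd_eq_of_newton [IsTopologicalAddGroup V] [T2Space V] (hanti : Antitone Λ)
    (hopen : ∀ j, IsOpen (Λ j : Set V))
    (hcomp : IsCompact (Λ k : Set V)) (hbasis : ∀ U ∈ 𝓝 (0 : V), ∃ j, (Λ j : Set V) ⊆ U)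
    (hψ : ContinuousOn ψ (Λ k : Set V))
    (hN : ∀ j, k ≤ j → ∀ x ∈ Λ k, ∀ y ∈ Λ j, ψ (x + y) - ψ x - y ∈ Λ (j + 1))
    {j : ℕ} (hj : k ≤ j) {x : V} (hx : x ∈ Λ k) :
    (Λ k : Set V) ∩ ψ ⁻¹' (ψ x +ᵥ (Λ j : Set V)) = x +ᵥ (Λ j : Set V) := by
  ext y
  constructor
  · rintro ⟨hy, hyS⟩
    rw [mem_preimage, ← image_vadd_eq_of_newton Λ ψ hanti hopen hcomp hbasis hψ hN hj hx] at hyS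
    obtain ⟨y', hy', hyy'⟩ := hyS
    have hy'k : y' ∈ (Λ k : Set V) := by
      obtain ⟨l, hl, rfl⟩ := hy'
      exact add_mem hx (hanti hj hl)
    rwa [← injOn_of_newton Λ ψ hanti hbasis hN hy'k hy hyy']
  · intro hy
    have hyk : y ∈ (Λ k : Set V) := by
      obtain ⟨l, hl, rfl⟩ := hy
      exact add_mem hx (hanti hj hl)
    exact ⟨hyk, mapsTo_vadd_of_newton Λ ψ hanti hN hj hx hy⟩

/-- The cosets `v + Λ j`, `j ≥ k`, form a topological basis of `V`. [cite: Serre1992LALG, Part II Ch. IV §9] -/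
theorem isTopologicalBasis_cosets [IsTopologicalAddGroup V] (hanti : Antitone Λ)
    (hopen : ∀ j, IsOpen (Λ j : Set V)) (hbasis : ∀ U ∈ 𝓝 (0 : V), ∃ j, (Λ j : Set V) ⊆ U) :
    IsTopologicalBasis {S : Set V | ∃ j, k ≤ j ∧ ∃ v : V, S = v +ᵥ (Λ j : Set V)} := by
  refine isTopologicalBasis_of_isOpen_of_nhds ?_ ?_
  · rintro _ ⟨j, -, v, rfl⟩
    exact (hopen j).vadd v
  · intro a u hau hu
    have hmem : (fun y => a + y) ⁻¹' u ∈ 𝓝 (0 : V) :=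
      (continuous_const_add a).continuousAt.preimage_mem_nhds (by simpa using hu.mem_nhds hau)
    obtain ⟨j, hj⟩ := hbasis _ hmem
    refine ⟨a +ᵥ (Λ (max j k) : Set V), ⟨max j k, le_max_right _ _, a, rfl⟩,
      ⟨0, zero_mem _, by simp⟩, ?_⟩
    rintro _ ⟨l, hl, rfl⟩
    exact hj (hanti (le_max_left j k) hl)

end Topology

/-! ## §3 The linear-part form: reduction to `ψ := L⁻¹ ∘ φ` -/

section Linear

variable {V W : Type*} [AddCommGroup V] [TopologicalSpace V] [AddCommGroup W] [TopologicalSpace W]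
  (Λ : ℕ → AddSubgroup V) {k : ℕ} (φ : V → W) (L : V ≃ₜ+ W)

/-- Reduction: `ψ := L⁻¹ ∘ φ` satisfies the filtered Newton hypothesis when `φ` satisfies it with linear part
`L`. [cite: Serre1992LALG, Part II Ch. IV §9] -/
theorem newton_symm_comp_of_linearNewton
    (hN : ∀ j, k ≤ j → ∀ x ∈ Λ k, ∀ y ∈ Λ j, φ (x + y) - φ x - L y ∈ L '' (Λ (j + 1) : Set V)) :
    ∀ j, k ≤ j → ∀ x ∈ Λ k, ∀ y ∈ Λ j, (L.symm ∘ φ) (x + y) - (L.symm ∘ φ) x - y ∈ Λ (j + 1) := by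
  intro j hj x hx y hy
  obtain ⟨z, hz, hzeq⟩ := hN j hj x hx y hy
  have : (L.symm ∘ φ) (x + y) - (L.symm ∘ φ) x - y = L.symm (φ (x + y) - φ x - L y) := by
    simp [map_sub]
  rw [this, ← hzeq]
  simpa using hz

/-- **Injectivity on the base box**, linear-part form. [cite: Serre1992LALG, Part II Ch. IV §9] -/
theorem injOn_of_linearNewton [T2Space V] (hanti : Antitone Λ)
    (hbasis : ∀ U ∈ 𝓝 (0 : V), ∃ j, (Λ j : Set V) ⊆ U)
    (hN : ∀ j, k ≤ j → ∀ x ∈ Λ k, ∀ y ∈ Λ j, φ (x + y) - φ x - L y ∈ L '' (Λ (j + 1) : Set V)) :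
    InjOn φ (Λ k : Set V) := by
  have h := injOn_of_newton Λ (L.symm ∘ φ) hanti hbasis (newton_symm_comp_of_linearNewton Λ φ L hN)
  intro x hx x' hx' hxx'
  exact h hx hx' (by simp [hxx'])

/-- **Coset images**, linear-part form: `φ '' (x + Λ j) = φ x + L '' Λ j`. [cite: Serre1992LALG, Part II Ch. IV §9] -/
theorem image_vadd_eq_of_linearNewton [IsTopologicalAddGroup V] [T2Space V] (hanti : Antitone Λ)
    (hopen : ∀ j, IsOpen (Λ j : Set V))
    (hcomp : IsCompact (Λ k : Set V)) (hbasis : ∀ U ∈ 𝓝 (0 : V), ∃ j, (Λ j : Set V) ⊆ U)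
    (hφ : ContinuousOn φ (Λ k : Set V))
    (hN : ∀ j, k ≤ j → ∀ x ∈ Λ k, ∀ y ∈ Λ j, φ (x + y) - φ x - L y ∈ L '' (Λ (j + 1) : Set V))
    {j : ℕ} (hj : k ≤ j) {x : V} (hx : x ∈ Λ k) :
    φ '' (x +ᵥ (Λ j : Set V)) = φ x +ᵥ L '' (Λ j : Set V) := by
  have hψ : ContinuousOn (L.symm ∘ φ) (Λ k : Set V) := L.symm.continuous.comp_continuousOn hφ
  have h := image_vadd_eq_of_newton Λ (L.symm ∘ φ) hanti hopen hcomp hbasis hψ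
    (newton_symm_comp_of_linearNewton Λ φ L hN) hj hx
  have hφ_eq : φ = L ∘ (L.symm ∘ φ) := by ext; simp
  conv_lhs => rw [hφ_eq, Set.image_comp, h]
  ext w
  simp only [Set.mem_image, Set.mem_vadd_set, vadd_eq_add, Function.comp_apply]
  constructor
  · rintro ⟨u, ⟨l, hl, rfl⟩, rfl⟩
    exact ⟨L l, ⟨l, hl, rfl⟩, by simp⟩
  · rintro ⟨_, ⟨l, hl, rfl⟩, rfl⟩
    exact ⟨L.symm (φ x) + l, ⟨l, hl, rfl⟩, by simp⟩

end Linear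

end Summit.HodgeConjecture.HodgeConjecture.Cruxes.H413.F0P3cStCharTSFilteredNewton
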